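import Mathlib
import Summits.NavierStokesRegularity.NavierStokesRegularity.Theorems.OddMorawetzMorawetzKillsTypeIWeightParity
import Summits.NavierStokesRegularity.NavierStokesRegularity.Theorems.OddMorawetzOddNoGoNS
import HarnessLib

/-!
# Crux `OddMorawetz.MorawetzKillsTypeI` (stmt-NavierStokesRegularity-1377), line `birth`:
  stub `stub_weightOne_structure` — coordinate form of a weight-one cubic jet density

A smooth density `m` on 3-jets `z = (z₀, z₁, z₂, z₃)` over `E = ℝ³` which is a pointwise cubic
form (`m (μ • z) = μ ^ 3 * m z` for ALL real `μ`) and has derivative weight `k = 1` under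
positive dilations (`m (z₀, s • z₁, s² • z₂, s³ • z₃) = s * m z` for `s > 0`) is, in
coordinates, `m z = Σ τ_ijpq z₀ᵢ z₀ⱼ (z₁ e_p)_q`: quadratic in the value slot `z₀`, linear in
the first-derivative slot `z₁`, independent of `z₂, z₃` (`stub_weightOne_structure`).

Proof.
* `weightOne_eq_fderiv`: `f(s) := m (z₀, s • z₁, s² • z₂, s³ • z₃)` has derivative
  `Dm(z₀,0,0,0)[(0,z₁,0,0)]` at `s = 0` (chain rule along the polynomial dilation curve) and
  agrees with `s * m z` on `(0, ∞)` and at `0` (both vanish there); uniqueness of one-sided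
  derivatives (`uniqueDiffWithinAt_Ioi`) gives `m z = Dm(z₀,0,0,0)[(0,z₁,0,0)]`, which is
  linear in `z₁` and independent of `z₂, z₃`.
* `weightOne_sq`: in `z₀` the density is then `2`-homogeneous for every real factor, because
  `Dm(μ w) = μ² Dm(w)` for `μ ≠ 0` (tree lemma `oddNoGoNS_fderiv_cubic`) and `Dm(0) = 0`
  (`weightOne_fderiv_zero_of_cubic`).
* `weightOne_two_mul_eq_fderiv_fderiv`: a smooth `2`-homogeneous real function is the quadratic
  form `½ D²h(0)[x, x]` (differentiate `μ ↦ h (μ x) = μ² h x` twice at `μ = 0`,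
  `ContinuousLinearMap.iteratedFDeriv_comp_right`; the order-two analogue of the tree lemma
  `six_mul_eq_iteratedFDeriv_of_cubic`).
* `weightOne_exists_coeff`: expand `z₀ = Σ z₀ᵢ eᵢ` (`EuclideanSpace.basisFun`) by
  bilinearity and `z₁ = Σ (z₁ e_p)_q E_pq` in the rank-one `1`-multilinear maps
  `E_pq : u ↦ (u 0)_p e_q` (`ContinuousMultilinearMap.ofSubsingleton`) by linearity.

Elementary multivariable calculus; no published source needed.
Lands `--supports stmt-NavierStokesRegularity-1377`.
-/

noncomputable section

-- the summit and its single problem share the name (D-0017 nested layout)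
set_option linter.dupNamespace false

namespace Summit.NavierStokesRegularity.NavierStokesRegularity.Theorems

/-! ### Homogeneous smooth functions -/

/-- **A smooth `2`-homogeneous function is a quadratic form.** If `h : V → ℝ` is smooth and
`h (μ • x) = μ ^ 2 * h x` for all real `μ`, then `2 * h x = D²h(0)[x, x]`, written as
`fderiv ℝ (fderiv ℝ h) 0 x x`.  Proof: the chain rule along the linear map `μ ↦ μ • x`
(`ContinuousLinearMap.iteratedFDeriv_comp_right`) and the second derivative of
`μ ↦ μ ^ 2 * h x` at `0`, namely `2 * h x`. -/
theorem weightOne_two_mul_eq_fderiv_fderiv {V : Type*} [NormedAddCommGroup V] [NormedSpace ℝ V]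
    {h : V → ℝ} (hh : ContDiff ℝ (⊤ : ℕ∞) h)
    (hsq : ∀ (μ : ℝ) (x : V), h (μ • x) = μ ^ 2 * h x) (x : V) :
    2 * h x = fderiv ℝ (fderiv ℝ h) 0 x x := by
  have h2 : ContDiff ℝ (2 : ℕ) h := contDiff_infty.mp hh 2
  have hcomp := (ContinuousLinearMap.toSpanSingleton ℝ x).iteratedFDeriv_comp_right h2 0
    (i := 2) le_rfl
  have hval := congrArg
    (fun T : ContinuousMultilinearMap ℝ (fun _ : Fin 2 => ℝ) ℝ => T fun _ => (1 : ℝ)) hcomp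
  simp only [ContinuousMultilinearMap.compContinuousLinearMap_apply,
    ContinuousLinearMap.toSpanSingleton_apply, one_smul, map_zero] at hval
  have happ : iteratedFDeriv ℝ 2 h 0 (fun _ => x) = fderiv ℝ (fderiv ℝ h) 0 x x :=
    iteratedFDeriv_two_apply h 0 _
  rw [← happ, ← hval, ← iteratedDeriv_eq_iteratedFDeriv]
  have hfun :
      (h ∘ ⇑(ContinuousLinearMap.toSpanSingleton ℝ x)) = fun μ : ℝ => μ ^ 2 * h x := by
    funext μ
    simp [ContinuousLinearMap.toSpanSingleton_apply, hsq]
  rw [hfun, iteratedDeriv_mul_const_field, iteratedDeriv_pow]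
  norm_num [Nat.descFactorial]

/-- **The derivative of a differentiable cubic form vanishes at the origin**: from
`Dm(μ z) = μ² Dm(z)` (tree lemma `oddNoGoNS_fderiv_cubic`) at `μ = 2`, `z = 0` we get
`Dm(0) = 4 Dm(0)`. -/
theorem weightOne_fderiv_zero_of_cubic {V : Type*} [NormedAddCommGroup V] [NormedSpace ℝ V]
    {m : V → ℝ} (hm : Differentiable ℝ m)
    (hcub : ∀ (μ : ℝ) (z : V), m (μ • z) = μ ^ 3 * m z) :
    fderiv ℝ m 0 = 0 := by
  have h := oddNoGoNS_fderiv_cubic hm hcub (μ := 2) two_ne_zero (0 : V)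
  rw [smul_zero] at h
  ext v
  have hv := congrArg (fun L : V →L[ℝ] ℝ => L v) h
  simp only [smul_apply, smul_eq_mul] at hv
  have hv0 : fderiv ℝ m 0 v = 0 := by linarith
  simpa using hv0

/-! ### Weight one: linear in `z₁`, quadratic in `z₀` -/

/-- **A weight-one density is the `z₁`-derivative at the zero fibre.** If `m` is
differentiable on `E₀ × F₁ × F₂ × F₃` and `m (z₀, s • z₁, s² • z₂, s³ • z₃) = s * m z` for all
`s > 0`, then `m z = Dm(z₀, 0, 0, 0)[(0, z₁, 0, 0)]`; in particular `m` is linear in `z₁` and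
does not depend on `z₂, z₃`.  Proof: `f(s) := m (z₀, s • z₁, s² • z₂, s³ • z₃)` has derivative
`Dm(z₀,0,0,0)[(0,z₁,0,0)]` at `0` by the chain rule, `f(s) = s * m z` on `(0, ∞)` and
`f(0) = m (z₀, 0, 0, 0) = 0` (weight one at `s = 2`), so the one-sided derivative at `0⁺` is
also `m z`; one-sided derivatives are unique (`uniqueDiffWithinAt_Ioi`). -/
theorem weightOne_eq_fderiv {E₀ F₁ F₂ F₃ : Type*}
    [NormedAddCommGroup E₀] [NormedSpace ℝ E₀] [NormedAddCommGroup F₁] [NormedSpace ℝ F₁]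
    [NormedAddCommGroup F₂] [NormedSpace ℝ F₂] [NormedAddCommGroup F₃] [NormedSpace ℝ F₃]
    {m : E₀ × F₁ × F₂ × F₃ → ℝ} (hm : Differentiable ℝ m)
    (hk : ∀ s : ℝ, 0 < s → ∀ (z₀ : E₀) (z₁ : F₁) (z₂ : F₂) (z₃ : F₃),
      m (z₀, s • z₁, (s ^ 2) • z₂, (s ^ 3) • z₃) = s * m (z₀, z₁, z₂, z₃))
    (z₀ : E₀) (z₁ : F₁) (z₂ : F₂) (z₃ : F₃) :
    m (z₀, z₁, z₂, z₃) = fderiv ℝ m (z₀, 0, 0, 0) (0, z₁, 0, 0) := by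
  -- `m` vanishes on the zero fibre
  have h0 : m (z₀, 0, 0, 0) = 0 := by
    have h := hk 2 two_pos z₀ 0 0 0
    simp only [smul_zero] at h
    linarith
  -- the dilation curve and its velocity at `s = 0`
  have hγ : HasDerivAt (fun s : ℝ => (z₀, s • z₁, (s ^ 2) • z₂, (s ^ 3) • z₃))
      ((0 : E₀), z₁, (0 : F₂), (0 : F₃)) 0 := by
    refine (hasDerivAt_const (0 : ℝ) z₀).prodMk (HasDerivAt.prodMk ?_ (HasDerivAt.prodMk ?_ ?_))
    · simpa using (hasDerivAt_id' (0 : ℝ)).smul_const z₁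
    · simpa using (hasDerivAt_pow 2 (0 : ℝ)).smul_const z₂
    · simpa using (hasDerivAt_pow 3 (0 : ℝ)).smul_const z₃
  have hpt : (fun s : ℝ => (z₀, s • z₁, (s ^ 2) • z₂, (s ^ 3) • z₃)) 0 = (z₀, 0, 0, 0) := by
    simp
  have hl : HasFDerivAt m (fderiv ℝ m (z₀, 0, 0, 0))
      ((fun s : ℝ => (z₀, s • z₁, (s ^ 2) • z₂, (s ^ 3) • z₃)) 0) := by
    rw [hpt]
    exact (hm _).hasFDerivAt
  -- two computations of the right derivative at `0`
  have hf : HasDerivWithinAt (fun s : ℝ => m (z₀, s • z₁, (s ^ 2) • z₂, (s ^ 3) • z₃))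
      (fderiv ℝ m (z₀, 0, 0, 0) (0, z₁, 0, 0)) (Set.Ioi 0) 0 :=
    (HasFDerivAt.comp_hasDerivAt
      (f := fun s : ℝ => (z₀, s • z₁, (s ^ 2) • z₂, (s ^ 3) • z₃)) (0 : ℝ) hl hγ).hasDerivWithinAt
  have hg : HasDerivWithinAt (fun s : ℝ => m (z₀, s • z₁, (s ^ 2) • z₂, (s ^ 3) • z₃))
      (m (z₀, z₁, z₂, z₃)) (Set.Ioi 0) 0 := by
    have h1 : HasDerivAt (fun s : ℝ => s * m (z₀, z₁, z₂, z₃)) (m (z₀, z₁, z₂, z₃)) 0 := by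
      simpa using (hasDerivAt_id' (0 : ℝ)).mul_const (m (z₀, z₁, z₂, z₃))
    refine h1.hasDerivWithinAt.congr (fun s hs => hk s hs z₀ z₁ z₂ z₃) ?_
    simp [h0]
  exact (uniqueDiffWithinAt_Ioi (0 : ℝ)).eq_deriv _ hg hf

/-- **A weight-one cubic density is `2`-homogeneous in the value slot**: under the hypotheses
of `weightOne_eq_fderiv` plus cubic homogeneity, `m (μ • z₀, w, 0, 0) = μ ^ 2 * m (z₀, w, 0, 0)`
for EVERY real `μ`.  For `μ ≠ 0` this is `Dm(μ z) = μ² Dm(z)` (`oddNoGoNS_fderiv_cubic`) at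
the zero fibre; for `μ = 0` it is `Dm(0) = 0` (`weightOne_fderiv_zero_of_cubic`). -/
theorem weightOne_sq {E₀ F₁ F₂ F₃ : Type*}
    [NormedAddCommGroup E₀] [NormedSpace ℝ E₀] [NormedAddCommGroup F₁] [NormedSpace ℝ F₁]
    [NormedAddCommGroup F₂] [NormedSpace ℝ F₂] [NormedAddCommGroup F₃] [NormedSpace ℝ F₃]
    {m : E₀ × F₁ × F₂ × F₃ → ℝ} (hm : Differentiable ℝ m)
    (hcub : ∀ (μ : ℝ) (z : E₀ × F₁ × F₂ × F₃), m (μ • z) = μ ^ 3 * m z)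
    (hk : ∀ s : ℝ, 0 < s → ∀ (z₀ : E₀) (z₁ : F₁) (z₂ : F₂) (z₃ : F₃),
      m (z₀, s • z₁, (s ^ 2) • z₂, (s ^ 3) • z₃) = s * m (z₀, z₁, z₂, z₃))
    (w : F₁) (μ : ℝ) (z₀ : E₀) :
    m (μ • z₀, w, 0, 0) = μ ^ 2 * m (z₀, w, 0, 0) := by
  rcases eq_or_ne μ 0 with rfl | hμ
  · rw [zero_smul, weightOne_eq_fderiv hm hk 0 w 0 0]
    have h00 : ((0 : E₀), (0 : F₁), (0 : F₂), (0 : F₃)) = (0 : E₀ × F₁ × F₂ × F₃) := rfl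
    rw [h00, weightOne_fderiv_zero_of_cubic hm hcub]
    simp
  · rw [weightOne_eq_fderiv hm hk (μ • z₀) w 0 0, weightOne_eq_fderiv hm hk z₀ w 0 0]
    have hsm : ((μ • z₀, 0, 0, 0) : E₀ × F₁ × F₂ × F₃) = μ • (z₀, 0, 0, 0) := by simp
    rw [hsm, oddNoGoNS_fderiv_cubic hm hcub hμ]
    simp

/-- **Reordering a four-fold finite sum** (move the last two indices to the front). -/
theorem weightOne_sum_comm₄ (t : Fin 3 → Fin 3 → Fin 3 → Fin 3 → ℝ) :
    ∑ p, ∑ q, ∑ i, ∑ j, t p q i j = ∑ i, ∑ j, ∑ p, ∑ q, t p q i j := by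
  calc ∑ p, ∑ q, ∑ i, ∑ j, t p q i j
      = ∑ p, ∑ i, ∑ q, ∑ j, t p q i j := Finset.sum_congr rfl fun p _ => Finset.sum_comm
    _ = ∑ i, ∑ p, ∑ q, ∑ j, t p q i j := Finset.sum_comm
    _ = ∑ i, ∑ p, ∑ j, ∑ q, t p q i j :=
        Finset.sum_congr rfl fun i _ => Finset.sum_congr rfl fun p _ => Finset.sum_comm
    _ = ∑ i, ∑ j, ∑ p, ∑ q, t p q i j := Finset.sum_congr rfl fun i _ => Finset.sum_comm

/-- **The standard basis expansion in `ℝ³`**: `x = Σᵢ xᵢ eᵢ` (`EuclideanSpace.basisFun`). -/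
theorem weightOne_eq_sum_smul_single (x : EuclideanSpace ℝ (Fin 3)) :
    x = ∑ i, x i • EuclideanSpace.single i (1 : ℝ) := by
  conv_lhs => rw [← (EuclideanSpace.basisFun (Fin 3) ℝ).sum_repr x]
  simp [EuclideanSpace.basisFun_apply]

/-- **Expansion of a `1`-multilinear map on `ℝ³` in rank-one maps.** If `E p q` is the
`1`-multilinear map `u ↦ (u 0)_p e_q`, then `z₁ = Σ_pq (z₁ e_p)_q E p q`: a `1`-multilinear map
is the linear map `x ↦ z₁ (fun _ => x)` (`ContinuousMultilinearMap.ofSubsingleton`), expand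
`x` in the standard basis. -/
theorem weightOne_eq_sum_smul_rankOne
    (E : Fin 3 → Fin 3 → EuclideanSpace ℝ (Fin 3) [×1]→L[ℝ] EuclideanSpace ℝ (Fin 3))
    (hE : ∀ p q (u : Fin 1 → EuclideanSpace ℝ (Fin 3)),
      E p q u = u 0 p • EuclideanSpace.single q (1 : ℝ))
    (z₁ : EuclideanSpace ℝ (Fin 3) [×1]→L[ℝ] EuclideanSpace ℝ (Fin 3)) :
    z₁ = ∑ p, ∑ q, z₁ (fun _ => EuclideanSpace.single p (1 : ℝ)) q • E p q := by
  -- the linear map `x ↦ z₁ (fun _ => x)`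
  set ℓ := (ContinuousMultilinearMap.ofSubsingleton ℝ (EuclideanSpace ℝ (Fin 3))
    (EuclideanSpace ℝ (Fin 3)) (0 : Fin 1)).symm z₁ with hℓ
  have hz : z₁ = ContinuousMultilinearMap.ofSubsingleton ℝ (EuclideanSpace ℝ (Fin 3))
      (EuclideanSpace ℝ (Fin 3)) (0 : Fin 1) ℓ := by
    rw [hℓ, Equiv.apply_symm_apply]
  have h1 : ∀ u : Fin 1 → EuclideanSpace ℝ (Fin 3),
      z₁ u = ∑ p, u 0 p • z₁ (fun _ => EuclideanSpace.single p (1 : ℝ)) := by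
    intro u
    rw [hz]
    simp only [ContinuousMultilinearMap.ofSubsingleton_apply_apply]
    conv_lhs => rw [weightOne_eq_sum_smul_single (u 0)]
    simp [map_sum, map_smul]
  ext u r
  rw [h1 u]
  simp [hE, Finset.sum_apply, Pi.single_apply]
  exact Finset.sum_congr rfl fun p _ => mul_comm _ _

/-- **Coordinates of a functional which is quadratic in `z₀ ∈ ℝ³` and linear in a
`1`-multilinear map `z₁` on `ℝ³`.** If `Φ x` is a continuous linear functional for each `x`
and `x ↦ Φ x w` is smooth and `2`-homogeneous for each `w`, then
`Φ z₀ z₁ = Σ τ_ijpq z₀ᵢ z₀ⱼ (z₁ e_p)_q` with `τ_ijpq = ½ D²(Φ · E_pq)(0)[eᵢ, eⱼ]`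
(`weightOne_two_mul_eq_fderiv_fderiv`, `weightOne_eq_sum_smul_single`, `weightOne_eq_sum_smul_rankOne`). -/
theorem weightOne_exists_coeff
    (Φ : EuclideanSpace ℝ (Fin 3) →
      (EuclideanSpace ℝ (Fin 3) [×1]→L[ℝ] EuclideanSpace ℝ (Fin 3)) →L[ℝ] ℝ)
    (hΦ : ∀ w, ContDiff ℝ (⊤ : ℕ∞) fun x => Φ x w)
    (hsq : ∀ w (μ : ℝ) x, Φ (μ • x) w = μ ^ 2 * Φ x w) :
    ∃ τ : Fin 3 → Fin 3 → Fin 3 → Fin 3 → ℝ, ∀ (z₀ : EuclideanSpace ℝ (Fin 3))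
        (z₁ : EuclideanSpace ℝ (Fin 3) [×1]→L[ℝ] EuclideanSpace ℝ (Fin 3)),
      Φ z₀ z₁ = ∑ i, ∑ j, ∑ p, ∑ q,
        τ i j p q * z₀ i * z₀ j * z₁ (fun _ => EuclideanSpace.single p (1 : ℝ)) q := by
  -- the rank-one `1`-multilinear maps `E p q : u ↦ (u 0)_p e_q`
  obtain ⟨E, hE⟩ : ∃ E : Fin 3 → Fin 3 →
      EuclideanSpace ℝ (Fin 3) [×1]→L[ℝ] EuclideanSpace ℝ (Fin 3),
      ∀ p q (u : Fin 1 → EuclideanSpace ℝ (Fin 3)),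
        E p q u = u 0 p • EuclideanSpace.single q (1 : ℝ) :=
    ⟨fun p q => ContinuousMultilinearMap.ofSubsingleton ℝ (EuclideanSpace ℝ (Fin 3))
        (EuclideanSpace ℝ (Fin 3)) (0 : Fin 1)
        ((EuclideanSpace.proj p).smulRight (EuclideanSpace.single q (1 : ℝ))),
      fun p q u => by simp⟩
  -- the quadratic forms `x ↦ Φ x w = ½ B w x x`
  obtain ⟨B, hB⟩ : ∃ B : (EuclideanSpace ℝ (Fin 3) [×1]→L[ℝ] EuclideanSpace ℝ (Fin 3)) →
      EuclideanSpace ℝ (Fin 3) →L[ℝ] EuclideanSpace ℝ (Fin 3) →L[ℝ] ℝ,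
      ∀ w x, Φ x w = 2⁻¹ * B w x x :=
    ⟨fun w => fderiv ℝ (fderiv ℝ fun x => Φ x w) 0, fun w x => by
      have h := weightOne_two_mul_eq_fderiv_fderiv (hΦ w) (hsq w) x
      simp only at h ⊢
      linarith⟩
  refine ⟨fun i j p q => 2⁻¹ * B (E p q) (EuclideanSpace.single i (1 : ℝ))
    (EuclideanSpace.single j (1 : ℝ)), fun z₀ z₁ => ?_⟩
  -- linearity in `z₁`
  have hlin : Φ z₀ z₁ =
      ∑ p, ∑ q, z₁ (fun _ => EuclideanSpace.single p (1 : ℝ)) q * Φ z₀ (E p q) := by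
    conv_lhs => rw [weightOne_eq_sum_smul_rankOne E hE z₁]
    simp [map_sum, map_smul]
  -- bilinearity in `z₀`, one slot at a time
  have hL : ∀ L : EuclideanSpace ℝ (Fin 3) →L[ℝ] ℝ,
      L z₀ = ∑ j, z₀ j * L (EuclideanSpace.single j (1 : ℝ)) := fun L => by
    conv_lhs => rw [weightOne_eq_sum_smul_single z₀]
    simp
  have hA : ∀ w, B w z₀ = ∑ i, z₀ i • B w (EuclideanSpace.single i (1 : ℝ)) := fun w => by
    conv_lhs => rw [weightOne_eq_sum_smul_single z₀]
    simp
  have hquad : ∀ w, B w z₀ z₀ = ∑ i, ∑ j, z₀ i * z₀ j *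
      B w (EuclideanSpace.single i (1 : ℝ)) (EuclideanSpace.single j (1 : ℝ)) := by
    intro w
    rw [hA w, sum_apply]
    refine Finset.sum_congr rfl fun i _ => ?_
    rw [smul_apply, smul_eq_mul, hL (B w (EuclideanSpace.single i (1 : ℝ))), Finset.mul_sum]
    refine Finset.sum_congr rfl fun j _ => ?_
    ring
  rw [hlin]
  simp only [hB, hquad, Finset.mul_sum]
  refine (weightOne_sum_comm₄ _).trans ?_
  refine Finset.sum_congr rfl fun i _ => Finset.sum_congr rfl fun j _ =>
    Finset.sum_congr rfl fun p _ => Finset.sum_congr rfl fun q _ => ?_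
  ring

/-! ### The stub -/

/-- **Coordinate form of a weight-one density** (stub `stub_weightOne_structure` of the line
`birth` of the crux `OddMorawetz.MorawetzKillsTypeI`).  A smooth, pointwise cubic density `m`
on 3-jets over `ℝ³` of derivative weight `k = 1` for positive dilations is the polynomial
`Σ τ_ijpq z₀ᵢ z₀ⱼ (z₁ e_p)_q` — quadratic in the value slot `z₀`, linear in the
first-derivative slot `z₁`, independent of `z₂, z₃`; here `z₁ (fun _ => e_p) q` is the
`(p, q)` entry `∂_p v_q` when `z₁ = Dv(x)` is viewed as a `1`-multilinear map.  Proof: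
`weightOne_eq_fderiv` (`m z = Dm(z₀,0,0,0)[(0,z₁,0,0)]`, linear in `z₁`), `weightOne_sq`
(`2`-homogeneous in `z₀`), `weightOne_exists_coeff` (basis expansion). -/
theorem stub_weightOne_structure :
    ∀ (k : ℕ) (m : EuclideanSpace ℝ (Fin 3) × (EuclideanSpace ℝ (Fin 3) [×1]→L[ℝ] EuclideanSpace ℝ (Fin 3)) × (EuclideanSpace ℝ (Fin 3) [×2]→L[ℝ] EuclideanSpace ℝ (Fin 3)) × (EuclideanSpace ℝ (Fin 3) [×3]→L[ℝ] EuclideanSpace ℝ (Fin 3)) → ℝ),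
      k = 1 → ContDiff ℝ (⊤ : ℕ∞) m → (∀ (μ : ℝ) z, m (μ • z) = μ ^ 3 * m z) →
      (∀ (s : ℝ), 0 < s → ∀ (z₀ : EuclideanSpace ℝ (Fin 3))
          (z₁ : EuclideanSpace ℝ (Fin 3) [×1]→L[ℝ] EuclideanSpace ℝ (Fin 3))
          (z₂ : EuclideanSpace ℝ (Fin 3) [×2]→L[ℝ] EuclideanSpace ℝ (Fin 3))
          (z₃ : EuclideanSpace ℝ (Fin 3) [×3]→L[ℝ] EuclideanSpace ℝ (Fin 3)),
          m (z₀, s • z₁, (s ^ 2) • z₂, (s ^ 3) • z₃) = s ^ k * m (z₀, z₁, z₂, z₃)) →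
      ∃ τ : Fin 3 → Fin 3 → Fin 3 → Fin 3 → ℝ, ∀ (z₀ : EuclideanSpace ℝ (Fin 3))
          (z₁ : EuclideanSpace ℝ (Fin 3) [×1]→L[ℝ] EuclideanSpace ℝ (Fin 3))
          (z₂ : EuclideanSpace ℝ (Fin 3) [×2]→L[ℝ] EuclideanSpace ℝ (Fin 3))
          (z₃ : EuclideanSpace ℝ (Fin 3) [×3]→L[ℝ] EuclideanSpace ℝ (Fin 3)),
        m (z₀, z₁, z₂, z₃) = ∑ i, ∑ j, ∑ p, ∑ q,
          τ i j p q * z₀ i * z₀ j * z₁ (fun _ => EuclideanSpace.single p (1 : ℝ)) q := by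
  intro k m hk1 hm hcub hk
  subst hk1
  have hmd : Differentiable ℝ m := hm.differentiable (by simp)
  have hk' : ∀ s : ℝ, 0 < s → ∀ (z₀ : EuclideanSpace ℝ (Fin 3))
      (z₁ : EuclideanSpace ℝ (Fin 3) [×1]→L[ℝ] EuclideanSpace ℝ (Fin 3))
      (z₂ : EuclideanSpace ℝ (Fin 3) [×2]→L[ℝ] EuclideanSpace ℝ (Fin 3))
      (z₃ : EuclideanSpace ℝ (Fin 3) [×3]→L[ℝ] EuclideanSpace ℝ (Fin 3)),
      m (z₀, s • z₁, (s ^ 2) • z₂, (s ^ 3) • z₃) = s * m (z₀, z₁, z₂, z₃) := by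
    intro s hs z₀ z₁ z₂ z₃
    simpa using hk s hs z₀ z₁ z₂ z₃
  -- the inclusion of the `z₁` slot and the functional `Φ z₀ = Dm(z₀,0,0,0) ∘ ι₁`
  obtain ⟨ι₁, hι⟩ : ∃ ι₁ : (EuclideanSpace ℝ (Fin 3) [×1]→L[ℝ] EuclideanSpace ℝ (Fin 3)) →L[ℝ]
      EuclideanSpace ℝ (Fin 3) × (EuclideanSpace ℝ (Fin 3) [×1]→L[ℝ] EuclideanSpace ℝ (Fin 3))
        × (EuclideanSpace ℝ (Fin 3) [×2]→L[ℝ] EuclideanSpace ℝ (Fin 3))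
        × (EuclideanSpace ℝ (Fin 3) [×3]→L[ℝ] EuclideanSpace ℝ (Fin 3)),
      ∀ z₁, ι₁ z₁ = (0, z₁, 0, 0) :=
    ⟨(ContinuousLinearMap.inr ℝ _ _).comp (ContinuousLinearMap.inl ℝ _ _), fun z₁ => rfl⟩
  obtain ⟨Φ, hΦ⟩ : ∃ Φ : EuclideanSpace ℝ (Fin 3) →
      (EuclideanSpace ℝ (Fin 3) [×1]→L[ℝ] EuclideanSpace ℝ (Fin 3)) →L[ℝ] ℝ,
      ∀ z₀ z₁, Φ z₀ z₁ = fderiv ℝ m (z₀, 0, 0, 0) (0, z₁, 0, 0) :=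
    ⟨fun z₀ => (fderiv ℝ m (z₀, 0, 0, 0)).comp ι₁, fun z₀ z₁ => by simp [hι]⟩
  have hΦm : ∀ (z₀ : EuclideanSpace ℝ (Fin 3))
      (z₁ : EuclideanSpace ℝ (Fin 3) [×1]→L[ℝ] EuclideanSpace ℝ (Fin 3))
      (z₂ : EuclideanSpace ℝ (Fin 3) [×2]→L[ℝ] EuclideanSpace ℝ (Fin 3))
      (z₃ : EuclideanSpace ℝ (Fin 3) [×3]→L[ℝ] EuclideanSpace ℝ (Fin 3)),
      m (z₀, z₁, z₂, z₃) = Φ z₀ z₁ := by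
    intro z₀ z₁ z₂ z₃
    rw [hΦ, weightOne_eq_fderiv hmd hk' z₀ z₁ z₂ z₃]
  have hsmooth : ∀ w, ContDiff ℝ (⊤ : ℕ∞) fun x => Φ x w := by
    intro w
    have hfun : (fun x => Φ x w) = fun x => m (x, w, 0, 0) :=
      funext fun x => (hΦm x w 0 0).symm
    rw [hfun]
    exact hm.comp (contDiff_prodMk_left _)
  have hsq : ∀ w (μ : ℝ) x, Φ (μ • x) w = μ ^ 2 * Φ x w := by
    intro w μ x
    rw [← hΦm (μ • x) w 0 0, ← hΦm x w 0 0]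
    exact weightOne_sq hmd hcub hk' w μ x
  obtain ⟨τ, hτ⟩ := weightOne_exists_coeff Φ hsmooth hsq
  exact ⟨τ, fun z₀ z₁ z₂ z₃ => (hΦm z₀ z₁ z₂ z₃).trans (hτ z₀ z₁)⟩

end Summit.NavierStokesRegularity.NavierStokesRegularity.Theorems

end
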